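import Mathlib
import HarnessLib

/-!
# LINE (A) `product_plus_one` (crux `MatrixDescartes`, stmt-ValiantsHypothesis-18050, V1) — THE PHASE LENS, ALGEBRA ONLY (pen memo §36.8 (c)):
# the logistic / cotangent-type letters `σ(z) = eᶻ/(1+eᶻ)`, `τ(z) = eᶻ/(eᶻ−1)` on ℂ, the HALF-PERIOD SWAP, their imaginary/real parts on horizontal lines,
# and the terminal identity (D) `2Re σ(x+iθ₊) − 2Re σ(x+iθ₋) = 2(cos θ₊ − cos θ₋)·X(1−X²)/(Q₊(X)Q₋(X))`, `Q_θ(X) = X² + 2X cos θ + 1 > 0`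

Source: p3 g20's phase-lens NOTE `pub/val-lit/lmr/NOTE-p3g20-18050-phase-lens.md` (Theorem B) as adopted by the pen (memo §36: (L) lens, (K) half-period kill,
(D) degree).  THIS FILE types only the ALGEBRA the lens uses — no argument principle, no zero counting (memo §36.8 (c): «no analysis; the four stubs stay
byte-frozen and OPEN»):
* `lensSigma`, `lensTau` (definitions, ℂ → ℂ);
* (K) ★ `lensSigma_add_pi_mul_I` : `σ(z + πi) = τ(z)`, ★ `lensTau_add_pi_mul_I` : `τ(z + πi) = σ(z)` — every rate-`r` row term `r·σ(r(u−y))` / `r·τ(r(u−q))`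
  is `2πi/r`-periodic and the height-`π/r` difference `D_{π/r}` swaps knees and poles (hence kills `σ − σ`, the NOTE's (F2));  `lensSigma_add_lensTau` :
  `σ(z) + τ(z) = 2τ(2z)` (the concentric knee+pole = one pole of double rate, memo §36.2 E1);
* `lensSigma_im/_re`, `lensTau_im/_re` on the line `z = x + iφ`: `Im σ = eˣ sin φ/(e²ˣ + 2eˣcos φ + 1)`, `Re σ = (eˣcos φ + e²ˣ)/(…)`,
  `Im τ = −eˣ sin φ/(e²ˣ − 2eˣ cos φ + 1)`, `Re τ = (e²ˣ − eˣ cos φ)/(…)` (with `e²ˣ` spelled `(exp x)²`), and `lensQ_pos` : `X² + 2X cos θ + 1 > 0` for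
  `X > 0`, `cos θ > −1`;
* (D) ★ `lens_terminal_identity` : for reals `X, c₊, c₋` with `Q± = X² + 2c±X + 1 ≠ 0`,
  `(Xc₊ + X²)/Q₊ − (Xc₋ + X²)/Q₋ = (c₊ − c₋)·X·(1 − X²)/(Q₊Q₋)` — with `lensSigma_re` this is the NOTE's terminal summand
  `D_{π/b}D_{π/c}(a·σ(a(u−y))) = −(a/2)(cos aη₊ − cos aη₋)·X(1−X²)/(Q₊Q₋)`, `X = e^{a(u−y)}`, `η± = π/b ± π/c` (★ `lens_knee_double_difference`).
* `lens_terminal_numerator_degree` — the terminal numerator `Σ_j λ_jX(1−λ_j²X²)∏_{i≠j}Q₊(λ_iX)Q₋(λ_iX) = X·N(X)` with `natDegree N ≤ 4n − 2`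
  (a `Polynomial ℝ` statement; memo §36.1 (D) «≤ 4n_a − 1 zeros»).
HONEST FRAMING: algebra of two elementary functions (helper); the lens's counting steps are PAPER (memo §36) and are not claimed here; nothing about
`WronskianBudgetK3` / `OneChangeFloorK3` / the stubs / 18050 / `MatrixDescartes`; `VP ≠ VNP` is NOT proved.  Two definitions, no named facts, no sorry.
-/

set_option linter.dupNamespace false

namespace Summit.ValiantsHypothesis.ValiantsHypothesis.Theorems.LacunarySymmetroidMatrixDescartes

namespace ProductPlusOne

open Complex

/-! ### §1 The two letters -/

/-- The logistic letter `σ(z) = eᶻ/(1 + eᶻ)` (height profile of a KNEE row in the phase lens). -/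
noncomputable def lensSigma (z : ℂ) : ℂ := exp z / (1 + exp z)

/-- The cotangent-type letter `τ(z) = eᶻ/(eᶻ − 1)` (profile of a POLE row). -/
noncomputable def lensTau (z : ℂ) : ℂ := exp z / (exp z - 1)

/-! ### §2 (K) the half-period swap and the doubling identity -/

/-- ★ **(K) half-period swap, knee → pole**: `σ(z + πi) = τ(z)`. [this file's theorem] -/
theorem lensSigma_add_pi_mul_I (z : ℂ) : lensSigma (z + Real.pi * I) = lensTau z := by
  unfold lensSigma lensTau
  rw [exp_add, exp_pi_mul_I, show exp z * (-1 : ℂ) = -exp z by ring, show (1 : ℂ) + -exp z = -(exp z - 1) by ring, neg_div_neg_eq]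

/-- ★ **(K) half-period swap, pole → knee**: `τ(z + πi) = σ(z)`. [this file's theorem] -/
theorem lensTau_add_pi_mul_I (z : ℂ) : lensTau (z + Real.pi * I) = lensSigma z := by
  unfold lensSigma lensTau
  rw [exp_add, exp_pi_mul_I, show exp z * (-1 : ℂ) = -exp z by ring, show -exp z - (1 : ℂ) = -(1 + exp z) by ring, neg_div_neg_eq]

/-- `σ` is `2πi`-periodic (so a rate-`r` knee term `σ(r·)` is `2πi/r`-periodic). [this file's lemma] -/
theorem lensSigma_add_two_pi_mul_I (z : ℂ) : lensSigma (z + 2 * Real.pi * I) = lensSigma z := by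
  unfold lensSigma; rw [exp_add, exp_two_pi_mul_I, mul_one]

/-- `τ` is `2πi`-periodic. [this file's lemma] -/
theorem lensTau_add_two_pi_mul_I (z : ℂ) : lensTau (z + 2 * Real.pi * I) = lensTau z := by
  unfold lensTau; rw [exp_add, exp_two_pi_mul_I, mul_one]

/-- **Doubling**: `σ(z) + τ(z) = 2·τ(2z)` wherever `eᶻ ≠ ±1` (a concentric knee + pole of rate `r` IS one pole of rate `2r`; memo §36.2 E1). [this file's lemma] -/
theorem lensSigma_add_lensTau (z : ℂ) (h1 : exp z ≠ 1) (h2 : exp z ≠ -1) : lensSigma z + lensTau z = 2 * lensTau (2 * z) := by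
  unfold lensSigma lensTau
  have e2 : exp (2 * z) = exp z ^ 2 := by rw [two_mul, exp_add, sq]
  rw [e2]
  have ha : 1 + exp z ≠ 0 := fun h => h2 (by linear_combination h)
  have hb : exp z - 1 ≠ 0 := fun h => h1 (by linear_combination h)
  have hc : exp z ^ 2 - 1 ≠ 0 := by
    have : exp z ^ 2 - 1 = (exp z - 1) * (1 + exp z) := by ring
    rw [this]; exact mul_ne_zero hb ha
  field_simp
  ring

/-! ### §3 Real and imaginary parts on a horizontal line -/

/-- `Im σ(x + iφ) = eˣ sin φ / ((eˣ)² + 2eˣ cos φ + 1)`. [this file's theorem] -/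
theorem lensSigma_im (x φ : ℝ) :
    (lensSigma (x + φ * I)).im = Real.exp x * Real.sin φ / (Real.exp x ^ 2 + 2 * Real.exp x * Real.cos φ + 1) := by
  unfold lensSigma
  have hre : (exp (x + φ * I)).re = Real.exp x * Real.cos φ := by rw [exp_re]; simp
  have him : (exp (x + φ * I)).im = Real.exp x * Real.sin φ := by rw [exp_im]; simp
  have hns : normSq (1 + exp (x + φ * I)) = Real.exp x ^ 2 + 2 * Real.exp x * Real.cos φ + 1 := by
    rw [normSq_apply]; simp only [add_re, one_re, add_im, one_im, hre, him, zero_add]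
    linear_combination (Real.exp x ^ 2) * Real.sin_sq_add_cos_sq φ
  rw [div_im, hns, ← sub_div]
  congr 1
  simp only [add_re, one_re, add_im, one_im, hre, him, zero_add]
  ring

/-- `Re σ(x + iφ) = (eˣ cos φ + (eˣ)²) / ((eˣ)² + 2eˣ cos φ + 1)`. [this file's theorem] -/
theorem lensSigma_re (x φ : ℝ) :
    (lensSigma (x + φ * I)).re = (Real.exp x * Real.cos φ + Real.exp x ^ 2) / (Real.exp x ^ 2 + 2 * Real.exp x * Real.cos φ + 1) := by
  unfold lensSigma
  have hre : (exp (x + φ * I)).re = Real.exp x * Real.cos φ := by rw [exp_re]; simp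
  have him : (exp (x + φ * I)).im = Real.exp x * Real.sin φ := by rw [exp_im]; simp
  have hns : normSq (1 + exp (x + φ * I)) = Real.exp x ^ 2 + 2 * Real.exp x * Real.cos φ + 1 := by
    rw [normSq_apply]; simp only [add_re, one_re, add_im, one_im, hre, him, zero_add]
    linear_combination (Real.exp x ^ 2) * Real.sin_sq_add_cos_sq φ
  rw [div_re, hns, ← add_div]
  congr 1
  simp only [add_re, one_re, add_im, one_im, hre, him, zero_add]
  linear_combination (Real.exp x ^ 2) * Real.sin_sq_add_cos_sq φ

/-- `Im τ(x + iφ) = −eˣ sin φ / ((eˣ)² − 2eˣ cos φ + 1)`. [this file's theorem] -/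
theorem lensTau_im (x φ : ℝ) :
    (lensTau (x + φ * I)).im = -(Real.exp x * Real.sin φ) / (Real.exp x ^ 2 - 2 * Real.exp x * Real.cos φ + 1) := by
  unfold lensTau
  have hre : (exp (x + φ * I)).re = Real.exp x * Real.cos φ := by rw [exp_re]; simp
  have him : (exp (x + φ * I)).im = Real.exp x * Real.sin φ := by rw [exp_im]; simp
  have hns : normSq (exp (x + φ * I) - 1) = Real.exp x ^ 2 - 2 * Real.exp x * Real.cos φ + 1 := by
    rw [normSq_apply]; simp only [sub_re, one_re, sub_im, one_im, hre, him, sub_zero]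
    linear_combination (Real.exp x ^ 2) * Real.sin_sq_add_cos_sq φ
  rw [div_im, hns, ← sub_div]
  congr 1
  simp only [sub_re, one_re, sub_im, one_im, hre, him, sub_zero]
  ring

/-- `Re τ(x + iφ) = ((eˣ)² − eˣ cos φ) / ((eˣ)² − 2eˣ cos φ + 1)`. [this file's theorem] -/
theorem lensTau_re (x φ : ℝ) :
    (lensTau (x + φ * I)).re = (Real.exp x ^ 2 - Real.exp x * Real.cos φ) / (Real.exp x ^ 2 - 2 * Real.exp x * Real.cos φ + 1) := by
  unfold lensTau
  have hre : (exp (x + φ * I)).re = Real.exp x * Real.cos φ := by rw [exp_re]; simp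
  have him : (exp (x + φ * I)).im = Real.exp x * Real.sin φ := by rw [exp_im]; simp
  have hns : normSq (exp (x + φ * I) - 1) = Real.exp x ^ 2 - 2 * Real.exp x * Real.cos φ + 1 := by
    rw [normSq_apply]; simp only [sub_re, one_re, sub_im, one_im, hre, him, sub_zero]
    linear_combination (Real.exp x ^ 2) * Real.sin_sq_add_cos_sq φ
  rw [div_re, hns, ← add_div]
  congr 1
  simp only [sub_re, one_re, sub_im, one_im, hre, him, sub_zero]
  linear_combination (Real.exp x ^ 2) * Real.sin_sq_add_cos_sq φ

/-- **The lens denominator is positive**: `X² + 2X·c + 1 > 0` for `X > 0`, `−1 < c` (in the lens `c = cos θ`, `θ ∉ π + 2πℤ`). [this file's lemma] -/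
theorem lensQ_pos (X c : ℝ) (hX : 0 < X) (hc : -1 < c) : 0 < X ^ 2 + 2 * X * c + 1 := by
  nlinarith [sq_nonneg (X - 1), mul_pos hX (show 0 < c + 1 by linarith)]

/-! ### §4 (D) the terminal identity -/

/-- ★ **(D) terminal identity, real form**: with `Q± = X² + 2c±X + 1 ≠ 0`,
`(Xc₊ + X²)/Q₊ − (Xc₋ + X²)/Q₋ = (c₊ − c₋)·X·(1 − X²)/(Q₊·Q₋)`. [this file's theorem] -/
theorem lens_terminal_identity (X cp cm : ℝ) (hp : X ^ 2 + 2 * X * cp + 1 ≠ 0) (hm : X ^ 2 + 2 * X * cm + 1 ≠ 0) :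
    (X * cp + X ^ 2) / (X ^ 2 + 2 * X * cp + 1) - (X * cm + X ^ 2) / (X ^ 2 + 2 * X * cm + 1)
      = (cp - cm) * X * (1 - X ^ 2) / ((X ^ 2 + 2 * X * cp + 1) * (X ^ 2 + 2 * X * cm + 1)) := by
  rw [div_sub_div _ _ hp hm]
  congr 1
  ring

/-- ★ **(D) for a knee term**: `Re σ(x+iθ₊) − Re σ(x+iθ₋) = (cos θ₊ − cos θ₋)·X(1−X²)/(Q₊Q₋)`, `X = eˣ`, `Q± = X² + 2X cos θ± + 1 ≠ 0` (off the
knee's own singular heights) — so the height-`(π/b, π/c)` double difference of a rate-`a` knee `a·σ(a(u−y))` is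
`−(a/2)(cos aη₊ − cos aη₋)·X(1−X²)/(Q₊Q₋)`, a rational function of `X = e^{a(u−y)}` (memo §36.1 (D)). [this file's theorem] -/
theorem lens_knee_double_difference (x θp θm : ℝ) (hp : Real.exp x ^ 2 + 2 * Real.exp x * Real.cos θp + 1 ≠ 0)
    (hm : Real.exp x ^ 2 + 2 * Real.exp x * Real.cos θm + 1 ≠ 0) :
    (lensSigma (x + θp * I)).re - (lensSigma (x + θm * I)).re
      = (Real.cos θp - Real.cos θm) * Real.exp x * (1 - Real.exp x ^ 2)
          / ((Real.exp x ^ 2 + 2 * Real.exp x * Real.cos θp + 1) * (Real.exp x ^ 2 + 2 * Real.exp x * Real.cos θm + 1)) := by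
  rw [lensSigma_re, lensSigma_re]
  exact lens_terminal_identity (Real.exp x) (Real.cos θp) (Real.cos θm) hp hm

/-! ### §5 The terminal function is `X·N(X)/∏Q` with `deg N ≤ 4n − 2` -/

/-- **Degree of the terminal numerator** (memo §36.1 (D)): for `n` rate-`a` rows with multipliers `λ_j` (`X_j = λ_j·X`) and the two cosines `c₊, c₋`,
`Σ_j λ_jX(1 − λ_j²X²)·∏_{i≠j} Q₊(λ_iX)Q₋(λ_iX) = X·N(X)` for a polynomial `N` of degree `≤ 4n − 2` (so the terminal function `F₂ = const·X·N(X)/∏_i Q₊Q₋`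
has at most `4n − 2` positive zeros off `X = 0`). [this file's theorem] -/
theorem lens_terminal_numerator_degree (n : ℕ) (lam : Fin n → ℝ) (cp cm : ℝ) :
    ∃ N : Polynomial ℝ, N.natDegree ≤ 4 * n - 2 ∧ ∀ X : ℝ,
      (∑ j, lam j * X * (1 - lam j ^ 2 * X ^ 2)
          * ∏ i ∈ Finset.univ.erase j, ((lam i * X) ^ 2 + 2 * (lam i * X) * cp + 1) * ((lam i * X) ^ 2 + 2 * (lam i * X) * cm + 1))
        = X * N.eval X := by
  classical
  let Qp : Fin n → Polynomial ℝ := fun i =>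
    Polynomial.C (lam i ^ 2) * Polynomial.X ^ 2 + Polynomial.C (2 * lam i * cp) * Polynomial.X + Polynomial.C 1
  let Qm : Fin n → Polynomial ℝ := fun i =>
    Polynomial.C (lam i ^ 2) * Polynomial.X ^ 2 + Polynomial.C (2 * lam i * cm) * Polynomial.X + Polynomial.C 1
  let T : Fin n → Polynomial ℝ := fun j =>
    Polynomial.C (lam j) * (Polynomial.C 1 - Polynomial.C (lam j ^ 2) * Polynomial.X ^ 2) * ∏ i ∈ Finset.univ.erase j, (Qp i * Qm i)
  refine ⟨∑ j, T j, ?_, ?_⟩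
  · -- degree bookkeeping: each summand has degree ≤ 0 + 2 + 4(n−1)
    refine Polynomial.natDegree_sum_le_of_forall_le _ _ fun j _ => ?_
    have hQp : ∀ i, (Qp i).natDegree ≤ 2 := fun i => Polynomial.natDegree_quadratic_le
    have hQm : ∀ i, (Qm i).natDegree ≤ 2 := fun i => Polynomial.natDegree_quadratic_le
    have hQQ : ∀ i, (Qp i * Qm i).natDegree ≤ 4 := fun i =>
      (Polynomial.natDegree_mul_le).trans (by have := hQp i; have := hQm i; omega)
    have hprod : (∏ i ∈ Finset.univ.erase j, (Qp i * Qm i)).natDegree ≤ 4 * (n - 1) := by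
      refine (Polynomial.natDegree_prod_le _ _).trans ?_
      calc ∑ i ∈ Finset.univ.erase j, (Qp i * Qm i).natDegree ≤ ∑ _i ∈ Finset.univ.erase j, 4 := Finset.sum_le_sum fun i _ => hQQ i
        _ = 4 * (n - 1) := by rw [Finset.sum_const, Finset.card_erase_of_mem (Finset.mem_univ j), Finset.card_fin, smul_eq_mul, mul_comm]
    have hlin : (Polynomial.C (lam j) * (Polynomial.C 1 - Polynomial.C (lam j ^ 2) * Polynomial.X ^ 2)).natDegree ≤ 2 := by
      refine (Polynomial.natDegree_C_mul_le _ _).trans ?_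
      refine (Polynomial.natDegree_sub_le _ _).trans ?_
      rw [max_le_iff]; refine ⟨by simp, ?_⟩
      exact Polynomial.natDegree_C_mul_X_pow_le _ _
    have hn : 0 < n := Fin.pos j
    calc (T j).natDegree ≤ 2 + 4 * (n - 1) := (Polynomial.natDegree_mul_le).trans (Nat.add_le_add hlin hprod)
      _ ≤ 4 * n - 2 := by omega
  · intro X
    have hfac : ∀ i, (Qp i * Qm i).eval X = ((lam i * X) ^ 2 + 2 * (lam i * X) * cp + 1) * ((lam i * X) ^ 2 + 2 * (lam i * X) * cm + 1) := by
      intro i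
      simp only [Qp, Qm, Polynomial.eval_mul, Polynomial.eval_add, Polynomial.eval_pow, Polynomial.eval_C, Polynomial.eval_X]
      ring
    rw [Polynomial.eval_finsetSum, Finset.mul_sum]
    refine Finset.sum_congr rfl fun j _ => ?_
    simp only [T, Polynomial.eval_mul, Polynomial.eval_prod, Polynomial.eval_sub, Polynomial.eval_pow, Polynomial.eval_C,
      Polynomial.eval_X, hfac]
    ring

end ProductPlusOne

end Summit.ValiantsHypothesis.ValiantsHypothesis.Theorems.LacunarySymmetroidMatrixDescartes
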